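import Summits.CriticalPhenomena.CardyFormulaZ2.Theses.CardyIKTransport
import Summits.CriticalPhenomena.CardyFormulaZ2.Theorems.CardyIKTransportIKLinearTransportLine
import Summits.CriticalPhenomena.CardyFormulaZ2.Theorems.IKLinearTransport.Negative.CruxConsequences
import Summits.CriticalPhenomena.CardyFormulaZ2.Theorems.IKLinearTransport.Negative.LoadBearing
import Summits.CriticalPhenomena.CardyFormulaZ2.Theorems.IKLinearTransport.Negative.Covariance
import Literature.Barriers.CriticalPhenomena.EmbeddingModulusUniquenessProofs
import Literature.Probability.LatticeModels.CornerFugacityMeasure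

/-!
# Line `anchor-ward-shear-flow` — crux `CardyIKTransport.IKLinearTransport` (stmt-CriticalPhenomena-5076)
# SKELETON v1 (crux-plan, 2026-08-16; the merged Ward line of triage r1-2 / r1-3:
# `anchor-ward-shear-flow` ≈ `abel-flux-ward`)

Skeleton of the line (D-0027 §3.2 (3)): FIVE registered stubs `stub_*` (the only `sorry`s), the
kernel-checked sorry-free composition `IKLinearTransport_of_stubs` (through the PROVED lemmas
`flowIntegration`, `dictionary_of_flow`, `crux_of_dictionary`), and the skeleton theorem
`IKLinearTransport_of : IKLinearTransport` (concludes the crux BY NAME, modulo the stubs).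

IDEA (crux idea cards `anchor-ward-shear-flow` + `abel-flux-ward`, triage r1-2/r1-3: pass, merge).
Read the commuting Izergin–Korepin family `IK(u)`, `u ∈ [π/3, π/2]`, as a FLOW from Smirnov's point
`u = π/3` (site percolation on `𝕋` drawn on `ℤ²` with one diagonal) to the crux's isotropic model
`u = π/2`, along which the spectral parameter IS the rhombus angle of the Z-invariant drawing
(Nienhuis 1990; Chelkak–Glazman–Smirnov arXiv:1604.06339 §2.1 at `s = 1`: weights
`(1, t, t, 1, b, 1-b)`, `t(u) = √3/(2 sin u)`, `b(u) = sin(2π/3-u)/sin u` = tree `ikCornerFugacity`,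
`ikCoinBias`). PREDICTION (the Transfer `C⁺`, `ShearDictionaryAt u`): `IK(u)` read on the images of
the rectangles under the EXPLICIT shear `K_u = φ_{e^{iu}}` (`moduliShear`, inline convention: the
preferred pair is the anti-diagonal) has Cardy limits for every `u`; `K_{π/3}` draws `𝕋` equilaterally
(Smirnov, PROVED in the tree), `K_{π/2} = φ_i = id` is the crux. ENGINE: the diagram-resolved
Yang–Baxter exchange holds for EVERY pair of parameters on the curve (`CurveDiagramExchangeAt`, stub 1,
verified by exact enumeration by three seats; the pair `(π/3, π/2)` is the other line's
`DiagramExchangeAt`, `diagramExchange_of_curve` below); its `u`-derivative on the diagonal is an exact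
CONSERVATION LAW (row/column flux vanishes on block-diagram-measurable events), which turns the bulk
Russo sum `∂_u P_u(crossing)` — `δ⁻²` signed terms — into the FIRST MOMENT of boundary-localised
covariances, i.e. a lattice Hadamard variation of the window; matching it with the window's response
to the explicit infinitesimal shear `K_u' K_u⁻¹` (boundary 3-arm ratio limits: THE heart, stub 5) makes
`u ↦ P_u(co-moving window)` asymptotically constant in small `u`-steps (`LocalTransportOn`, the
differential form, uniform BEFORE `δ → 0`), and the steps telescope (`flowIntegration`, PROVED here)
to flow invariance, hence — with the anchor — to the dictionary at every `u`, hence to the crux at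
`u = π/2` with `K = id` (`crux_of_dictionary`, PROVED: `Negative.crux_iff_cardyOnImages` + `Pu_pi_div_two`).
At the anchor the conservation law is even LOCAL (CGS Cor. 2.6 hexagon identity, exact at `s = 1`,
ideator-verified on the radius-2 patch) and the measure is Bernoulli: the first landable milestone
inside stub 5 is the one-sided response `AnchorShearResponse` (line card §Milestones, typed there).

THE MODEL (§1): the crux's explicit i.i.d.-bit gauge, made homogeneous in `u`: `μU u` = fair axis bits
× `Bernoulli(p(u))` plaquettes (`p = t/(1+t)`, `defectDensity`) × (unused fair plaquettes) ×
`Bernoulli(b(u))` anti-diagonal coins; observables and the crude event VERBATIM the vocabulary's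
(`obs univ`, `blackEdges`, `embDomainCrossing sqEmb`, 2δ slack). `μU (π/2) = μIK` ON THE NOSE
(`μU_pi_div_two`: `p(π/2) = 2√3-3`, `b(π/2) = ½`), so `Pu (π/2) = Negative.Pik` (`Pu_pi_div_two`); the
`u = π/3` member (plaquettes fair, coins a.s. anti) is site percolation on `triGraph` in law.

DISPROOF USED (Cruxes/IKLinearTransport/Disproof.lean cycle 1 + landed Negative/{CruxConsequences,
LoadBearing, Covariance}, all imported here): `crux_iff_cardyOnImages` IS the last step of the
composition; `iKLinearTransport_false_without_axisBits` / `_false_without_slack` constrain the MODEL —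
both features are kept verbatim in `μU` / `Pu` (the axis bits are what makes every box marginal the free
corner field, used by stubs 2–5; the slack is where the wall flux of stub 5 lives, triage r1-3 A.3);
`crux_forces_limits_mem_Ioo` is honoured by stub 2 (RSW, both box directions, uniformly in `u`);
`crux_forces_covariance` / `conjugateToTri_congr_mul` (K only up to similarity) is why the explicit
`K_{π/2} = id` costs nothing at the endpoint (route items IKQuarterTurn + AnchorByRigidity pin any `K` to a
similarity). Negatives index (8 CriticalPhenomena entries): no stub is an instance or a rewording.

CONVENTION CHECK (triage r1-2 item 2 / r1-3 B.2, the mirror slip of `WithinFamilyShear`): this file is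
typed over the INLINE gauge (anti-diagonal `(1,-1)` preferred, `S = ∅`-type member = `triGraph`,
`triEmbed = φ_{e^{iπ/3}}`), for which the correct shear is `φ_{e^{iu}}` (`rhombAngle u = e^{iu}`); the
tree's `ikCrossingProb` (NE–SW convention) would need `e^{i(π-u)}` instead. No gauge bridge to
`ikCrossingProb` is needed by this skeleton.
-/

noncomputable section

namespace Summit.CriticalPhenomena.CardyFormulaZ2.Cruxes.IKLinearTransport.AnchorWardShearFlow

open scoped BigOperators Topology Classical MeasureTheory ENNReal Real
open Filter Set Function MeasureTheory
open Literature.Probability.Percolation Literature.Probability.LatticeModels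
open Literature.Probability.RandomPlanarGeometry
open Literature.Barriers.CriticalPhenomena
open Summit.CriticalPhenomena.CardyFormulaZ2.Theorems.IKLinearTransport.PinnedDiagramExchange
open Summit.CriticalPhenomena.CardyFormulaZ2.Theorems.IKLinearTransport.Negative
  (Pik CardyOnImages crux_iff_cardyOnImages markedDomain_map_map)

/-! ## §1 The homogeneous Izergin–Korepin family `IK(u)` in the crux's inline gauge -/

/-- Plaquette-defect density `p(u) = t(u)/(1+t(u))` of the explicit gauge, `t(u) = √3/(2 sin u)` the
corner fugacity (`ikCornerFugacity`): the XOR gauge turns i.i.d. `Bernoulli(p)` plaquette bits into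
the free corner-fugacity field with `t = p/(1-p)`; `p(π/2) = 2√3 - 3`, `p(π/3) = ½`. [folklore] -/
def defectDensity (u : ℝ) : ℝ := (ikCornerFugacity u : ℝ) / (1 + (ikCornerFugacity u : ℝ))

/-- The gauge measure of `IK(u)`: fair row/column sign bits, `Bernoulli(p(u))` plaquette bits, an
unused fair plaquette field (kept so that `u = π/2` is the crux's measure on the nose), and
`Bernoulli(b(u))` ANTI-diagonal coins, `b(u) = sin(2π/3-u)/sin u` (`ikCoinBias`; in this inline
convention the preferred pair is the anti-diagonal `{f+(1,0), f+(0,1)}`, forced at `u = π/3`, where the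
triangulation is `triGraph`). [folklore] -/
def μU (u : ℝ) : Measure Ω :=
  (sitePercolation ℤ half).prod ((sitePercolation ℤ half).prod
    ((sitePercolation (Site 2) (Set.projIcc (0:ℝ) 1 zero_le_one (defectDensity u))).prod
      ((sitePercolation (Site 2) half).prod (sitePercolation (Site 2) (ikCoinBias u)))))

/-- Crude crossing probability of the conformal rectangle `R` at mesh `δ` for `IK(u)` drawn on the
square grid (the crux's event verbatim: `embDomainCrossing sqEmb`, 2δ endpoint slack kept, cf.
`Negative.iKLinearTransport_false_without_slack`; axis bits kept, cf. `_false_without_axisBits`). [folklore] -/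
def Pu (u : ℝ) (R : ConformalRectangle) (δ : ℝ) : ℝ :=
  (μU u).real {ω | blackEdges (obs Set.univ ω) ∈ embDomainCrossing sqEmb R.carrier δ (R.arc 0) (R.arc 2)}

/-- `p(π/2) = 2√3 - 3`. [folklore] -/
theorem defectDensity_pi_div_two : defectDensity (π / 2) = 2 * Real.sqrt 3 - 3 := by
  rw [defectDensity, coe_ikCornerFugacity_pi_div_two]
  have h3 : Real.sqrt 3 ^ 2 = 3 := Real.sq_sqrt (by norm_num)
  have hpos : (0:ℝ) < 1 + Real.sqrt 3 / 2 := by positivity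
  rw [div_eq_iff hpos.ne']
  nlinarith [h3]

/-- `b(π/2) = ½` as an element of `[0,1]`. [folklore] -/
theorem ikCoinBias_pi_div_two_eq_half : ikCoinBias (π / 2) = half :=
  Subtype.ext (by rw [coe_ikCoinBias_pi_div_two]; rfl)

/-- At the isotropic point the gauge measure IS the crux's `μIK`. [folklore] -/
theorem μU_pi_div_two : μU (π / 2) = μIK := by
  rw [μU, μIK, defectDensity_pi_div_two, ikCoinBias_pi_div_two_eq_half]

/-- At the isotropic point the family IS the crux's `P_IK` (`Negative.Pik`, via the vocabulary's
`mixedCrossingProb_univ`). [folklore] -/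
theorem Pu_pi_div_two (R : ConformalRectangle) : Pu (π / 2) R = Pik R := by
  rw [← mixedCrossingProb_univ]
  funext δ
  simp only [Pu, mixedCrossingProb, μU_pi_div_two]

/-! ## §2 The explicit shear `K_u = φ_{e^{iu}}` (Z-invariant drawing, inline convention) -/

/-- The rhombus modulus `α_u = e^{iu}`: `IK(u)` is the `n = 1`, `x = 1` loop model on the rhombic
drawing of `ℤ²` with faces spanned by `1` and `e^{iu}` (Nienhuis' Z-invariant weights at rhombus angle
`u`; Chelkak–Glazman–Smirnov arXiv:1604.06339 §2.1 at `s = 1`); the short diagonal `e^{iu} - 1` is the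
anti-diagonal, forced at `u = π/3` (`α = e^{iπ/3} = triZeta`: `triEmbed`), and `α_{π/2} = i`
(`moduliShear i = id`). [folklore] -/
def rhombAngle (u : ℝ) : ℂ := Complex.exp ((u : ℂ) * Complex.I)

/-- `Im α_u = sin u`. [folklore] -/
theorem rhombAngle_im (u : ℝ) : (rhombAngle u).im = Real.sin u := by
  simp [rhombAngle, Complex.exp_ofReal_mul_I_im]

/-- `α_{π/2} = i`. [folklore] -/
theorem rhombAngle_pi_div_two : rhombAngle (π / 2) = Complex.I := by
  rw [rhombAngle, show ((π / 2 : ℝ) : ℂ) = (π : ℂ) / 2 by push_cast; ring, Complex.exp_pi_div_two_mul_I]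

/-- `sin u ≠ 0` on `[π/3, π/2]`. [folklore] -/
theorem sin_ne_zero_of_mem_Icc {u : ℝ} (hu : u ∈ Set.Icc (π / 3) (π / 2)) : Real.sin u ≠ 0 :=
  (Real.sin_pos_of_pos_of_lt_pi (by linarith [Real.pi_pos, hu.1]) (by linarith [hu.2, Real.pi_pos])).ne'

/-- `α_u` is non-real on `[π/3, π/2]`. [folklore] -/
theorem rhombAngle_im_ne_zero {u : ℝ} (hu : u ∈ Set.Icc (π / 3) (π / 2)) : (rhombAngle u).im ≠ 0 := by
  rw [rhombAngle_im]; exact sin_ne_zero_of_mem_Icc hu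

/-- Beffara's shear `φ_β` as a real-linear automorphism of `ℂ` (the crux's `K` lives in
`ℂ ≃L[ℝ] ℂ`; the tree's `shearHomeomorph` is only a homeomorphism). [folklore] -/
def shearLinearEquiv (β : ℂ) (hβ : β.im ≠ 0) : ℂ ≃ₗ[ℝ] ℂ where
  toFun := moduliShear β
  map_add' z w := by
    simp only [moduliShear, Complex.add_re, Complex.add_im, Complex.ofReal_add]; ring
  map_smul' r z := by
    simp only [moduliShear, RingHom.id_apply, Complex.real_smul, Complex.re_ofReal_mul,
      Complex.im_ofReal_mul, Complex.ofReal_mul]; ring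
  invFun := moduliShear ((Complex.I - (β.re : ℂ)) / (β.im : ℂ))
  left_inv z := by
    show moduliShear _ (moduliShear β z) = z
    rw [moduliShear_moduliShear, moduliShear_connect hβ, moduliShear_I_apply]
  right_inv z := by
    show moduliShear β (moduliShear _ z) = z
    rw [moduliShear_moduliShear, moduliShear_invParam hβ, moduliShear_I_apply]

/-- The shear as a continuous linear equivalence. [folklore] -/
def shearCLE (β : ℂ) (hβ : β.im ≠ 0) : ℂ ≃L[ℝ] ℂ := (shearLinearEquiv β hβ).toContinuousLinearEquiv

/-- `shearCLE β` acts as `φ_β`. [folklore] -/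
@[simp] theorem shearCLE_apply (β : ℂ) (hβ : β.im ≠ 0) (z : ℂ) : shearCLE β hβ z = moduliShear β z := rfl

/-- Images of marked domains under the identity homeomorphism. [folklore] -/
theorem markedDomain_map_refl {n : ℕ} (D : MarkedDomain n) : D.map (Homeomorph.refl ℂ) = D := by
  obtain ⟨⟨c, b, h1, h2, h3, h4, h5, h6, h7⟩, mark, hm, hm'⟩ := D
  simp only [MarkedDomain.map, JordanDomain.map]
  congr 1
  congr 1
  exact Set.image_id c

/-- Two real-linear automorphisms conjugated to the same map by one shear coincide as plane
homeomorphisms (the co-moving maps of the flow are determined by their defining equation). [folklore] -/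
theorem toHomeomorph_eq_of_shear {β : ℂ} (hβ : β.im ≠ 0) {M M' : ℂ ≃L[ℝ] ℂ} {g : ℂ → ℂ}
    (hM : ∀ z, moduliShear β (M z) = g z) (hM' : ∀ z, moduliShear β (M' z) = g z) :
    M.toHomeomorph = M'.toHomeomorph := by
  ext z
  have hinj : Function.Injective (moduliShear β) := (shearCLE β hβ).injective
  exact hinj ((hM z).trans (hM' z).symm)

/-! ## §3 Stub statement 1 · the curve-wide pinned Yang–Baxter identity (engine) -/

/-- Local face weight of `IK(u)` in the colouring-plus-diagonal representation:
`t(u)^{[odd]} · (b(u) if the face carries the anti-diagonal else 1 - b(u))` (on `[π/3, 2π/3]` the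
clamps of `ikCornerFugacity` / `ikCoinBias` are inactive: `coe_ikCornerFugacity`, `coe_ikCoinBias`). [folklore] -/
def faceWeightU (u : ℝ) (odd anti : Bool) : ℝ :=
  (if odd then (ikCornerFugacity u : ℝ) else 1) * (if anti then (ikCoinBias u : ℝ) else 1 - (ikCoinBias u : ℝ))

/-- Weight of a configuration of the three-column cylinder block `Fin 3 × ℤ/L` with spectral
parameters `u 0`, `u 1` on its two face columns (block conventions = the vocabulary's `blockGraph`,
`faceOdd`, `blockDiagram`, i.e. those of the other line). [folklore] -/
def blockWeightU (L : ℕ) [NeZero L] (u : Fin 2 → ℝ) (col : Fin 3 × ZMod L → Bool)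
    (a : Fin 2 × ZMod L → Bool) : ℝ :=
  ∏ f : Fin 2 × ZMod L, faceWeightU (u f.1) (faceOdd L col f) (a f)

/-- Diagram-resolved (pinned) two-column transfer weight with parameters `u`. [folklore] -/
def pinnedWeightU (L : ℕ) [NeZero L] (u : Fin 2 → ℝ) (ξ ζ : ZMod L → Bool)
    (Δ : Set ((Fin 2 × ZMod L) × (Fin 2 × ZMod L))) : ℝ :=
  ∑ η : ZMod L → Bool, ∑ a : Fin 2 × ZMod L → Bool,
    if blockDiagram L (fun x => (![ξ, η, ζ] : Fin 3 → ZMod L → Bool) x.1 x.2) a = Δ then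
      blockWeightU L u (fun x => (![ξ, η, ζ] : Fin 3 → ZMod L → Bool) x.1 x.2) a else 0

/-- STUB STATEMENT 1 at circumference `L` · `CurveDiagramExchangeAt L` (registered stub
`stub_CurveDiagramExchange : ∀ L [NeZero L], 3 ≤ L → CurveDiagramExchangeAt L`): for every pair
`u₁, u₂ ∈ [π/3, 2π/3]` on the integrable curve (all nine face weights nonnegative), every pair of
boundary colourings and every boundary connectivity diagram, the pinned weights of (u₁ below u₂) and
(u₂ below u₁) agree. Colour-summed it is the Yang–Baxter commutation of the dilute `A₂⁽²⁾` row transfer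
matrices (arXiv:2211.12379 §3.5); the diagram level is the annular dilute Temperley–Lieb identity
(triage r1-3 sharpening); exact enumeration: 0 mismatches, `L ≤ 5`, six pairs, three seats. The pair
`(π/3, π/2)` is the other line's `DiagramExchangeAt L` (`diagramExchange_of_curve`). A statement the
route POSITS. [folklore] -/
def CurveDiagramExchangeAt (L : ℕ) [NeZero L] : Prop :=
  ∀ u₁ ∈ Set.Icc (π / 3) (2 * π / 3), ∀ u₂ ∈ Set.Icc (π / 3) (2 * π / 3),
    ∀ (ξ ζ : ZMod L → Bool) (Δ : Set ((Fin 2 × ZMod L) × (Fin 2 × ZMod L))),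
      pinnedWeightU L ![u₁, u₂] ξ ζ Δ = pinnedWeightU L ![u₂, u₁] ξ ζ Δ

/-- The isotropic face weights are the other line's `faceWeight true`. [folklore] -/
theorem faceWeightU_pi_div_two : faceWeightU (π / 2) = faceWeight true := by
  funext odd anti
  cases odd <;> cases anti <;>
    simp [faceWeightU, faceWeight, coe_ikCornerFugacity_pi_div_two, coe_ikCoinBias_pi_div_two] <;> ring

/-- The honeycomb face weights are the other line's `faceWeight false`. [folklore] -/
theorem faceWeightU_pi_div_three : faceWeightU (π / 3) = faceWeight false := by
  funext odd anti
  cases odd <;> cases anti <;> simp [faceWeightU, faceWeight]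

/-- Block weights, pair `(π/3, π/2)`. [folklore] -/
theorem blockWeightU_anchor_iso (L : ℕ) [NeZero L] (col : Fin 3 × ZMod L → Bool)
    (a : Fin 2 × ZMod L → Bool) :
    blockWeightU L ![π / 3, π / 2] col a = blockWeight L ![false, true] col a := by
  unfold blockWeightU blockWeight
  refine Finset.prod_congr rfl fun f _ => ?_
  rcases f with ⟨j, r⟩
  fin_cases j <;> simp [faceWeightU_pi_div_two, faceWeightU_pi_div_three]

/-- Block weights, pair `(π/2, π/3)`. [folklore] -/
theorem blockWeightU_iso_anchor (L : ℕ) [NeZero L] (col : Fin 3 × ZMod L → Bool)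
    (a : Fin 2 × ZMod L → Bool) :
    blockWeightU L ![π / 2, π / 3] col a = blockWeight L ![true, false] col a := by
  unfold blockWeightU blockWeight
  refine Finset.prod_congr rfl fun f _ => ?_
  rcases f with ⟨j, r⟩
  fin_cases j <;> simp [faceWeightU_pi_div_two, faceWeightU_pi_div_three]

/-- CROSS-LINE LINK (proved): the other line's registered stub `stub_DiagramExchange` is the pair
`(π/3, π/2)` of this line's stub 1 — one algebraic input, two lines. [folklore] -/
theorem diagramExchange_of_curve (L : ℕ) [NeZero L] (h : CurveDiagramExchangeAt L) :
    DiagramExchangeAt L := by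
  intro ξ ζ Δ
  have h13 : (π / 3 : ℝ) ∈ Set.Icc (π / 3) (2 * π / 3) := ⟨le_rfl, by linarith [Real.pi_pos]⟩
  have h12 : (π / 2 : ℝ) ∈ Set.Icc (π / 3) (2 * π / 3) :=
    ⟨by linarith [Real.pi_pos], by linarith [Real.pi_pos]⟩
  have := h (π / 3) h13 (π / 2) h12 ξ ζ Δ
  simp only [pinnedWeightU, blockWeightU_anchor_iso, blockWeightU_iso_anchor] at this
  simpa [pinnedWeight] using this

/-! ## §4 Stub statement 2 · box crossings for the homogeneous family, uniformly in `u` -/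

/-- STUB STATEMENT 2 · `BoxCrossingBound c u n a b` (registered stub `stub_BoxCrossing : ∃ c > 0,
∀ u ∈ [π/3, π/2], ∀ n ≥ 1, ∀ a b, BoxCrossingBound c u n a b`): the `2n × n` and the `n × 2n` cell boxes
at `(a, b)` are crossed the long way by a black path of `IK(u)` with probability `≥ c` (both shapes: the
model is anisotropic for `u ≠ π/2`; white = black in law by the axis-bit flip). The HOMOGENEOUS cases of
the route's r4 `IKMixedBoxCrossing` (stmt-5911) extended along `u`; the a-priori input every line needs
(`Negative.crux_forces_limits_mem_Ioo`). A statement the route POSITS. [folklore] -/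
def BoxCrossingBound (c u : ℝ) (n : ℕ) (a b : ℤ) : Prop :=
  c ≤ (μU u).real {ω | obs Set.univ ω ∈ lrCross a b (2 * n) n} ∧
    c ≤ (μU u).real {ω | obs Set.univ ω ∈ tbCross a b n (2 * n)}

/-! ## §5 Stub statements 3–5 · the explicit-shear dictionary and the Ward flow -/

/-- `ShearDictionaryAt u` — the card's Transfer `C⁺` at parameter `u` (registered stub 3 is its anchor
instance `stub_AnchorCardyTri : ShearDictionaryAt (π/3)`): read on the `K_u`-images of the rectangles,
`K_u = φ_{e^{iu}}`, the crude `IK(u)` crossing probabilities have Cardy limits. At `u = π/3`: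
Smirnov's theorem `hasCrossingLimit_triDomainCrossingProb_holds` (PROVED in the tree) + the in-law
identification of the `u = π/3` gauge with site percolation on `triGraph` (fair XOR colours, coins a.s.
anti) + crude-event (2δ slack, all cells in `Ω`) versus G02 `triCrossing` glue under the shear
`φ_{e^{iπ/3}} ∘ sqEmb = triEmbed` — the same content as the other line's `stub_CrudeCardyTri`. At
`u = π/2` it is the crux (`crux_of_dictionary`). A statement the route POSITS. [folklore] -/
def ShearDictionaryAt (u : ℝ) : Prop :=
  ∀ K : ℂ ≃L[ℝ] ℂ, (∀ z, K z = moduliShear (rhombAngle u) z) →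
    ∀ R : ConformalRectangle,
      ConformalRectangle.HasCrossingLimit (R.map K.toHomeomorph) (Pu u R)
        Literature.Probability.RandomPlanarGeometry.cardyFunction

/-- `FlowInvariantAt R u` (PROVED from the stubs, `flowIntegration`): the crossing probabilities of
`IK(u)` in `R` and of `IK(π/3)` in the co-moving window `M R`, `K_{π/3} ∘ M = K_u`, are asymptotically
equal. [folklore] -/
def FlowInvariantAt (R : ConformalRectangle) (u : ℝ) : Prop :=
  ∀ M : ℂ ≃L[ℝ] ℂ, (∀ z, moduliShear (rhombAngle (π / 3)) (M z) = moduliShear (rhombAngle u) z) →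
    Tendsto (fun δ => Pu u R δ - Pu (π / 3) (R.map M.toHomeomorph) δ) (𝓝[>] 0) (𝓝 0)

/-- STUB STATEMENT 4 · `UniformLipschitzOn R` (registered stub `stub_BulkCancellation : (stub-1
statement) → (stub-2 statement) → ∀ R, UniformLipschitzOn R`): `u ↦ Pu u R δ` is Lipschitz on
`[π/3, π/2]` UNIFORMLY in small `δ`. Content: the bulk Russo sum `∂_u Pu = Σ_faces Cov(∂_u log w_f ; E)`
(`δ⁻²` signed terms of size up to `δ^{5/4}`) is cancelled identically in the interior by the
exchange-flux conservation law (the `u₂`-derivative of stub 1 on the diagonal; abel-flux-ward (J1′)) and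
what survives is a boundary sum of half-plane 3-arm size `δ²` per boundary cell with an affine weight —
`O(1)` in total; near `u = π/3` the singular insertion `(log(1-b))′ ∼ 1/(u-π/3)` is compensated by the
tile frequency `1-b ∼ u-π/3`. Inputs: stub 2 + boundary 3-arm upper bounds for `IK(u)` without FKG. The
real shadow `UniformLipschitzInU` of card smirnov-germ-continuation (triage r1-2 App. E: numerically
supported up to 14×7, incl. complex `u`). A statement the route POSITS. [folklore] -/
def UniformLipschitzOn (R : ConformalRectangle) : Prop :=
  ∃ C δ₀ : ℝ, 0 < δ₀ ∧ ∀ δ ∈ Set.Ioo 0 δ₀, ∀ u ∈ Set.Icc (π / 3) (π / 2), ∀ u' ∈ Set.Icc (π / 3) (π / 2),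
    |Pu u R δ - Pu u' R δ| ≤ C * |u - u'|

/-- STUB STATEMENT 5 · `LocalTransportOn R` — THE HEART, Ward = Hadamard (registered stub
`stub_WardHadamard : (stub 1) → (stub 2) → (∀ R, UniformLipschitzOn R) → ∀ R, LocalTransportOn R`).
The DIFFERENTIAL form of the dictionary, uniform before `δ → 0`: one `u`-step of size `h < h₀(ε)` along
the co-moving windows of `R` (reference parameter `v`: the window `M R` at parameter `s+h` and `N R` at
parameter `s` have the same `K`-image `K_v R`) changes the crude crossing probability by at most `ε h`
for all `δ < δ₀(h)`, uniformly in `s`, `v`. Mechanism: (J1′) first-moment formula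
`∂_u P_u(E) = Σ_j j Φ_j(E)` on `ℤ/N × ℤ` from stub 1; (J2) localisation of the flux `Φ_j(crossing)`
into wall and rim densities (stub 4's toolkit); (J3) IDENTIFICATION of the two boundary ratio limits
with the normal displacement of the explicit field `V_u = K_u′K_u⁻¹` (wall `∓1/sin u`, rim `cot u` per
column/row push: triage r1-3 B.1) — boundary 3-arm ratio limits for the non-FKG `IK(u)`, the crux of the
line —, equivalently the Hadamard expansion of `P_u` under the small linear deformation `N⁻¹M` of the
window; (J4) uniform integrability at `π/3`; planar windows from cylinders by decorrelation, Jordan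
windows from lattice polygons by an RSW sandwich. Its `u = π/3`, first-order instance is the milestone
`AnchorShearResponse` (Bernoulli measure: FKG, GPS pivotal measures, CGS Cor. 2.6 local law). Size XL.
A statement the route POSITS. [folklore] -/
def LocalTransportOn (R : ConformalRectangle) : Prop :=
  ∀ ε > 0, ∃ h₀ > 0, ∀ h ∈ Set.Ioo 0 h₀, ∃ δ₀ > 0, ∀ δ ∈ Set.Ioo 0 δ₀,
    ∀ v ∈ Set.Icc (π / 3) (π / 2), ∀ s : ℝ, π / 3 ≤ s → s + h ≤ π / 2 →
      ∀ M N : ℂ ≃L[ℝ] ℂ,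
        (∀ z, moduliShear (rhombAngle (s + h)) (M z) = moduliShear (rhombAngle v) z) →
        (∀ z, moduliShear (rhombAngle s) (N z) = moduliShear (rhombAngle v) z) →
          |Pu (s + h) (R.map M.toHomeomorph) δ - Pu s (R.map N.toHomeomorph) δ| ≤ ε * h

/-! ## §6 Sorry-free: integration of the flow, the dictionary, the crux -/

/-- INTEGRATION OF THE FLOW (proved): the local transport steps telescope from `u` down to `π/3`
(`n` steps of size `(u - π/3)/n < h₀(ε/2)`, each `≤ εh/2` for `δ < δ₀`, co-moving maps
`M_k = K_{s_k}⁻¹ K_u` built from `shearCLE`). [folklore] -/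
theorem flowIntegration (hL : ∀ R : ConformalRectangle, LocalTransportOn R) :
    ∀ R : ConformalRectangle, ∀ u ∈ Set.Icc (π / 3) (π / 2), FlowInvariantAt R u := by
  intro R u hu M hM
  have h3mem : (π / 3 : ℝ) ∈ Set.Icc (π / 3) (π / 2) := ⟨le_rfl, by linarith [Real.pi_pos]⟩
  have h3 : (rhombAngle (π / 3)).im ≠ 0 := rhombAngle_im_ne_zero h3mem
  rw [Metric.tendsto_nhds]
  intro ε hε
  rcases eq_or_lt_of_le hu.1 with heq | hlt
  · -- `u = π/3`: `M` is the identity and the difference vanishes identically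
    have hMid : M.toHomeomorph = (ContinuousLinearEquiv.refl ℝ ℂ).toHomeomorph :=
      toHomeomorph_eq_of_shear (g := moduliShear (rhombAngle u)) h3 hM (fun z => by rw [← heq]; rfl)
    have hrefl : (ContinuousLinearEquiv.refl ℝ ℂ).toHomeomorph = Homeomorph.refl ℂ := by
      ext z; rfl
    have hR : R.map M.toHomeomorph = R := by rw [hMid, hrefl, markedDomain_map_refl]
    refine Filter.Eventually.of_forall fun δ => ?_
    rw [hR, ← heq, sub_self, dist_self]
    exact hε
  · -- `u > π/3`: telescope `n` local steps of size `h = (u - π/3)/n < h₀`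
    set d : ℝ := u - π / 3 with hd
    have hdpos : 0 < d := by rw [hd]; linarith
    have hdle : d ≤ 1 := by
      rw [hd]; linarith [Real.pi_le_four, hu.2]
    have hε2 : 0 < ε / 2 := by linarith
    obtain ⟨h₀, hh₀, hstep⟩ := hL R (ε / 2) hε2
    obtain ⟨n, hn⟩ := exists_nat_gt (d / h₀)
    have hnpos : (0 : ℝ) < n := lt_of_le_of_lt (div_nonneg hdpos.le hh₀.le) hn
    have hn0 : (n : ℝ) ≠ 0 := hnpos.ne'
    set h : ℝ := d / n with hhdef
    have hhpos : 0 < h := div_pos hdpos hnpos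
    have hhlt : h < h₀ := by
      rw [hhdef, div_lt_iff₀ hnpos]
      calc d = d / h₀ * h₀ := by field_simp
        _ < n * h₀ := by nlinarith
        _ = h₀ * n := by ring
    obtain ⟨δ₀, hδ₀, hδ⟩ := hstep h ⟨hhpos, hhlt⟩
    -- the clamped intermediate parameters and the co-moving maps
    set s : ℕ → ℝ := fun k => min (π / 3 + k * h) (π / 2) with hsdef
    have hs_mem : ∀ k, s k ∈ Set.Icc (π / 3) (π / 2) := fun k =>
      ⟨le_min (by nlinarith [hhpos.le, (Nat.cast_nonneg k : (0:ℝ) ≤ k)]) (by linarith [Real.pi_pos]),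
        min_le_right _ _⟩
    have hs_eq : ∀ k : ℕ, (k : ℝ) ≤ n → s k = π / 3 + k * h := by
      intro k hk
      apply min_eq_left
      have : (k : ℝ) * h ≤ n * h := by nlinarith [hhpos.le]
      have hnh : (n : ℝ) * h = d := by rw [hhdef]; field_simp
      rw [hd] at hnh
      linarith [hu.2]
    have hu' : (rhombAngle u).im ≠ 0 := rhombAngle_im_ne_zero hu
    set Ku : ℂ ≃L[ℝ] ℂ := shearCLE (rhombAngle u) hu' with hKu
    set Mk : ℕ → (ℂ ≃L[ℝ] ℂ) := fun k =>
      Ku.trans (shearCLE (rhombAngle (s k)) (rhombAngle_im_ne_zero (hs_mem k))).symm with hMk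
    have hMk : ∀ k z, moduliShear (rhombAngle (s k)) (Mk k z) = moduliShear (rhombAngle u) z := by
      intro k z
      show (shearCLE (rhombAngle (s k)) (rhombAngle_im_ne_zero (hs_mem k)))
          ((shearCLE (rhombAngle (s k)) (rhombAngle_im_ne_zero (hs_mem k))).symm (Ku z)) = _
      rw [ContinuousLinearEquiv.apply_symm_apply]
      rfl
    -- endpoints
    have hs0 : s 0 = π / 3 := by
      rw [hs_eq 0 (by exact_mod_cast Nat.zero_le n)]; simp
    have hsn : s n = u := by
      rw [hs_eq n le_rfl, hhdef]; field_simp; rw [hd]; ring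
    have hM0 : (Mk 0).toHomeomorph = M.toHomeomorph :=
      toHomeomorph_eq_of_shear (g := moduliShear (rhombAngle u)) h3
        (fun z => by have := hMk 0 z; rwa [hs0] at this) hM
    have hMn : R.map (Mk n).toHomeomorph = R := by
      have h1 : (Mk n).toHomeomorph = (ContinuousLinearEquiv.refl ℝ ℂ).toHomeomorph :=
        toHomeomorph_eq_of_shear (g := moduliShear (rhombAngle u)) hu'
          (fun z => by have := hMk n z; rwa [hsn] at this) (fun z => rfl)
      have hrefl : (ContinuousLinearEquiv.refl ℝ ℂ).toHomeomorph = Homeomorph.refl ℂ := by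
        ext z; rfl
      rw [h1, hrefl, markedDomain_map_refl]
    -- the eventual bound
    have hev : ∀ᶠ δ in 𝓝[>] (0 : ℝ), δ ∈ Set.Ioo 0 δ₀ := Ioo_mem_nhdsGT hδ₀
    refine hev.mono fun δ hδmem => ?_
    set T : ℕ → ℝ := fun k => Pu (s k) (R.map (Mk k).toHomeomorph) δ with hT
    have hstepk : ∀ k, k < n → |T (k + 1) - T k| ≤ ε / 2 * h := by
      intro k hk
      have hk1 : ((k + 1 : ℕ) : ℝ) ≤ n := by exact_mod_cast hk
      have hk0 : (k : ℝ) ≤ n := by exact_mod_cast hk.le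
      have hsk1 : s (k + 1) = s k + h := by
        rw [hs_eq (k + 1) hk1, hs_eq k hk0]; push_cast; ring
      have hle : s k + h ≤ π / 2 := by rw [← hsk1]; exact (hs_mem (k + 1)).2
      have := hδ δ hδmem u hu (s k) (hs_mem k).1 hle (Mk (k + 1)) (Mk k)
        (fun z => by rw [← hsk1]; exact hMk (k + 1) z) (hMk k)
      simpa [hT, hsk1] using this
    have htel : T n - T 0 = ∑ k ∈ Finset.range n, (T (k + 1) - T k) :=
      (Finset.sum_range_sub T n).symm
    have hbound : |T n - T 0| ≤ n * (ε / 2 * h) := by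
      rw [htel]
      calc |∑ k ∈ Finset.range n, (T (k + 1) - T k)|
          ≤ ∑ k ∈ Finset.range n, |T (k + 1) - T k| := Finset.abs_sum_le_sum_abs _ _
        _ ≤ ∑ k ∈ Finset.range n, ε / 2 * h :=
            Finset.sum_le_sum fun k hk => hstepk k (Finset.mem_range.1 hk)
        _ = n * (ε / 2 * h) := by rw [Finset.sum_const, Finset.card_range, nsmul_eq_mul]
    have hnh : (n : ℝ) * (ε / 2 * h) = ε / 2 * d := by
      rw [hhdef]; field_simp
    have hTn : T n = Pu u R δ := by
      show Pu (s n) (R.map (Mk n).toHomeomorph) δ = Pu u R δ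
      rw [hMn, hsn]
    have hT0 : T 0 = Pu (π / 3) (R.map M.toHomeomorph) δ := by
      show Pu (s 0) (R.map (Mk 0).toHomeomorph) δ = _
      rw [hM0, hs0]
    rw [Real.dist_eq, sub_zero, ← hTn, ← hT0]
    calc |T n - T 0| ≤ n * (ε / 2 * h) := hbound
      _ = ε / 2 * d := hnh
      _ ≤ ε / 2 * 1 := by nlinarith
      _ < ε := by linarith

/-- Local alias of the crux decl (conclusion of the sorry-free composition). [folklore] -/
abbrev CruxStatement : Prop :=
  Summit.CriticalPhenomena.CardyFormulaZ2.Theses.CardyIKTransport.IKLinearTransport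

/-- ANCHOR + FLOW ⇒ DICTIONARY (proved): Cardy along `K_{π/3}` for `IK(π/3)` and flow invariance give
Cardy along `K_u` for `IK(u)`, every `u ∈ [π/3, π/2]` (co-moving map `M = K_{π/3}⁻¹ ∘ K`,
`(R.map M).map K_{π/3} = R.map K` by `Negative.markedDomain_map_map`). [folklore] -/
theorem dictionary_of_flow (hA : ShearDictionaryAt (π / 3))
    (hF : ∀ R : ConformalRectangle, ∀ u ∈ Set.Icc (π / 3) (π / 2), FlowInvariantAt R u) :
    ∀ u ∈ Set.Icc (π / 3) (π / 2), ShearDictionaryAt u := by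
  intro u hu K hK R φ x hφx
  have h3 : (rhombAngle (π / 3)).im ≠ 0 :=
    rhombAngle_im_ne_zero ⟨le_rfl, by linarith [Real.pi_pos]⟩
  set K₃ : ℂ ≃L[ℝ] ℂ := shearCLE (rhombAngle (π / 3)) h3 with hK₃
  set M : ℂ ≃L[ℝ] ℂ := K.trans K₃.symm with hMdef
  have hM : ∀ z, moduliShear (rhombAngle (π / 3)) (M z) = moduliShear (rhombAngle u) z := by
    intro z
    have h1 : moduliShear (rhombAngle (π / 3)) (M z) = K₃ (K₃.symm (K z)) := rfl
    rw [h1, K₃.apply_symm_apply, hK]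
  have hT := hF R u hu M hM
  have hA' := hA K₃ (shearCLE_apply _ h3) (R.map M.toHomeomorph)
  have hcomp : M.toHomeomorph.trans K₃.toHomeomorph = K.toHomeomorph := by
    ext z
    show K₃ (K₃.symm (K z)) = K z
    exact K₃.apply_symm_apply (K z)
  rw [markedDomain_map_map, hcomp] at hA'
  have hlim := hA' φ x hφx
  have := hT.add hlim
  simpa using this

/-- DICTIONARY AT `π/2` ⇒ CRUX (proved): `K_{π/2} = φ_i = id`, `Pu (π/2) = P_IK`, and the crux is Cardy
for `P_IK` on `K`-images (`Negative.crux_iff_cardyOnImages`, Smirnov's theorem inside). [folklore] -/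
theorem crux_of_dictionary (h : ShearDictionaryAt (π / 2)) : CruxStatement := by
  show Summit.CriticalPhenomena.CardyFormulaZ2.Theses.CardyIKTransport.IKLinearTransport
  rw [crux_iff_cardyOnImages]
  refine ⟨ContinuousLinearEquiv.refl ℝ ℂ, fun R => ?_⟩
  have hK : ∀ z, (ContinuousLinearEquiv.refl ℝ ℂ) z = moduliShear (rhombAngle (π / 2)) z := by
    intro z; simp [rhombAngle_pi_div_two]
  have := h _ hK R
  rwa [Pu_pi_div_two] at this

/-- THE COMPOSITION (kernel-checked, no `sorry`): the five registered stub signatures imply the crux.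
`flowIntegration` telescopes stub 5's local steps, `dictionary_of_flow` adds the anchor (stub 3),
`crux_of_dictionary` specialises to `u = π/2`. Stubs 1, 2, 4 enter as the hypotheses of stubs 4, 5.
[folklore] -/
theorem IKLinearTransport_of_stubs :
    (∀ (L : ℕ) [NeZero L], 3 ≤ L → CurveDiagramExchangeAt L) →
    (∃ c : ℝ, 0 < c ∧ ∀ u ∈ Set.Icc (π / 3) (π / 2), ∀ n : ℕ, 1 ≤ n → ∀ a b : ℤ,
      BoxCrossingBound c u n a b) →
    ShearDictionaryAt (π / 3) →
    ((∀ (L : ℕ) [NeZero L], 3 ≤ L → CurveDiagramExchangeAt L) →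
      (∃ c : ℝ, 0 < c ∧ ∀ u ∈ Set.Icc (π / 3) (π / 2), ∀ n : ℕ, 1 ≤ n → ∀ a b : ℤ,
        BoxCrossingBound c u n a b) →
      ∀ R : ConformalRectangle, UniformLipschitzOn R) →
    ((∀ (L : ℕ) [NeZero L], 3 ≤ L → CurveDiagramExchangeAt L) →
      (∃ c : ℝ, 0 < c ∧ ∀ u ∈ Set.Icc (π / 3) (π / 2), ∀ n : ℕ, 1 ≤ n → ∀ a b : ℤ,
        BoxCrossingBound c u n a b) →
      (∀ R : ConformalRectangle, UniformLipschitzOn R) →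
      ∀ R : ConformalRectangle, LocalTransportOn R) →
    CruxStatement := by
  intro hCDE hRSW hAnchor hLip hWard
  have hFlow := flowIntegration (hWard hCDE hRSW (hLip hCDE hRSW))
  exact crux_of_dictionary
    (dictionary_of_flow hAnchor hFlow (π / 2) ⟨by linarith [Real.pi_pos], le_rfl⟩)

/-! ## Registered stubs (the only `sorry`s of the line) -/

/-- STUB 1 · the pinned Yang–Baxter identity on every cylinder `ℤ/L`, `L ≥ 3`, for EVERY pair of
spectral parameters on the curve (the engine; annular dilute Temperley–Lieb at `n = 1`; size M–L). -/
theorem stub_CurveDiagramExchange : ∀ (L : ℕ) [NeZero L], 3 ≤ L → CurveDiagramExchangeAt L := by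
  sorry

/-- STUB 2 · RSW for the homogeneous family `IK(u)`, uniformly in `u ∈ [π/3, π/2]` (no FKG: Gibbs–Markov
screening of the gauge at rate `(7-4√3)^d`, finite energy, exact self-duality, conditional FKG of the coin
layer given the colours; size L). -/
theorem stub_BoxCrossing :
    ∃ c : ℝ, 0 < c ∧ ∀ u ∈ Set.Icc (π / 3) (π / 2), ∀ n : ℕ, 1 ≤ n → ∀ a b : ℤ,
      BoxCrossingBound c u n a b := by
  sorry

/-- STUB 3 · the anchor: Cardy for the `u = π/3` member (site percolation on `𝕋` drawn on `ℤ²`) read on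
`K_{π/3}`-images — Smirnov's theorem (proved in the tree) + gauge identification + crude-event glue
(size M–L; same content as the other line's `stub_CrudeCardyTri`). -/
theorem stub_AnchorCardyTri : ShearDictionaryAt (π / 3) := by
  sorry

/-- STUB 4 · bulk cancellation / boundary localisation: `u ↦ Pu u R δ` is Lipschitz uniformly in small
`δ` (exchange-flux conservation law from stub 1 + stub 2 + boundary 3-arm upper bounds; size L). -/
theorem stub_BulkCancellation :
    (∀ (L : ℕ) [NeZero L], 3 ≤ L → CurveDiagramExchangeAt L) →
      (∃ c : ℝ, 0 < c ∧ ∀ u ∈ Set.Icc (π / 3) (π / 2), ∀ n : ℕ, 1 ≤ n → ∀ a b : ℤ,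
        BoxCrossingBound c u n a b) →
      ∀ R : ConformalRectangle, UniformLipschitzOn R := by
  sorry

/-- STUB 5 · THE HEART (Ward = Hadamard): the exchange-flux identity turns the model increment into the
boundary first moment, which is the window increment along the explicit flow `K_u = φ_{e^{iu}}`; boundary
3-arm ratio limits for `IK(u)` without FKG (size XL; the lead's stub; first milestone: its `u = π/3`
first-order instance `AnchorShearResponse`, line card). -/
theorem stub_WardHadamard :
    (∀ (L : ℕ) [NeZero L], 3 ≤ L → CurveDiagramExchangeAt L) →
      (∃ c : ℝ, 0 < c ∧ ∀ u ∈ Set.Icc (π / 3) (π / 2), ∀ n : ℕ, 1 ≤ n → ∀ a b : ℤ,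
        BoxCrossingBound c u n a b) →
      (∀ R : ConformalRectangle, UniformLipschitzOn R) →
      ∀ R : ConformalRectangle, LocalTransportOn R := by
  sorry

/-- THE SKELETON THEOREM (D-0027 §3.3): concludes the crux `IKLinearTransport` BY NAME, modulo exactly
the five registered stubs `stub_*` (the only `sorry`s of this file). -/
theorem IKLinearTransport_of :
    Summit.CriticalPhenomena.CardyFormulaZ2.Theses.CardyIKTransport.IKLinearTransport :=
  IKLinearTransport_of_stubs stub_CurveDiagramExchange stub_BoxCrossing stub_AnchorCardyTri
    stub_BulkCancellation stub_WardHadamard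

end Summit.CriticalPhenomena.CardyFormulaZ2.Cruxes.IKLinearTransport.AnchorWardShearFlow
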